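import Summits.ABC.ABC.Theorems.IsogenyGlueCongruenceEllipticGluingPrimeBoundStubBigImageTorsionCoreAux1
import Literature.NumberTheory.EllipticCurves.GaloisAction
import HarnessLib

/-!
# Big-image torsion core, helpers 3/5: the isotypic lemma and the averaging step

Helper file (3/5) for stub `stub_bigImageTorsionCore` ((N†), the big-image torsion core) of
line `Sketch` (isotypic–Minkowski reduction) of crux U
`Summit.ABC.ABC.Theses.IsogenyGlueCongruence.EllipticGluingPrimeBound` (stmt-ABC-13919); the stub
itself is proved in `…EllipticGluingPrimeBoundStubBigImageTorsionCore`.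

* `exists_vector_not_mem` — step 1 (the isotypic lemma): for an `ℓ`-torsion subgroup `S ≤ P^r`
  stable under the twisted operators with an equivariant surjection `π' : S ↠ V = P[ℓ]`, when the
  operators of `Γ' = ker ρ` span `End(V)`: `S ∩ V^r` and `ker π' ∩ V^r` are of the form `S₀ ⊗ V`,
  `θ(w) = π'(x ⊗ w)` is a scalar for `x ∈ S₀ ∖ S₀'`, and `c̄(σ)x - x ∈ S₀'` for all `σ ∈ Γ`;
* `false_of_invariant_line` (registered sub-goal) — step 2 (averaging): with `ρ(Γ)` finite of order
    prime to `ℓ` and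
  `H^Γ = 0`, no such `x` exists (lift to `H`, average over the image, reduce mod `ℓ`).

Everything is proved; no `def`, no named fact. Deliberately NOT here: the assembled core and the
geometry (main file and helpers 4–5/5).
-/

noncomputable section

-- `Summit.<Summit>.<Problem>` is the mandated summit-side namespace (CONVENTIONS §2); for the
-- single-conjunct summit `ABC` the two coincide, so the duplicate `ABC.ABC` is deliberate.
set_option linter.dupNamespace false

namespace Summit.ABC.ABC.Theorems.IsotypicMinkowski

open scoped AddSubgroup

namespace BigImage

/-! ## The core, step 1: the isotypic lemma -/

/-- **Core, step 1 (the isotypic lemma).** With `V = P[ℓ]` a plane over `𝔽_ℓ` on which the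
operators of `Γ' = ker ρ` span `End(V)`: given an `ℓ`-torsion subgroup `S ≤ P^r` stable under
the twisted operators and an equivariant surjection `π' : S ↠ V`, write `S[ℓ] ⊆ V^r = 𝔽_ℓ^r ⊗ V`.
Both `S` and `ker π'` are of the form `S₀ ⊗ V` (stability under `End(V)` acting on the right
factor), some `x ∈ S₀ ∖ S₀'` exists, `θ(w) = π'(x ⊗ w)` commutes with `Γ'` hence is a scalar,
and comparing `π'(σ(x ⊗ v)) = π'(c̄(σ)x ⊗ σv)` with `σ θ(v) = θ(σv)` shows `c̄(σ)x - x ∈ S₀'`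
for every `σ ∈ Γ`: the line of `x` in `𝔽_ℓ^r / S₀'` is `Γ`-invariant. [folklore] -/
theorem exists_vector_not_mem {Γ P H : Type} [Group Γ] [AddCommGroup P] [AddCommGroup H]
    [DistribMulAction Γ P] {ℓ : ℕ} [Fact ℓ.Prime]
    [Module (ZMod ℓ) (AddSubgroup.torsionBy P ℓ)] (bV : Module.Basis (Fin 2) (ZMod ℓ)
        (AddSubgroup.torsionBy P ℓ))
    (ρ : Representation ℤ Γ H) {r : ℕ} (b : Module.Basis (Fin r) ℤ H)
    (hspan : Submodule.span (ZMod ℓ) (Set.range fun σ : MonoidHom.ker ρ ↦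
      (DistribSMul.toAddMonoidHom (AddSubgroup.torsionBy P ℓ) (σ : Γ)).toZModLinearMap ℓ) = ⊤)
    (S : AddSubgroup (Fin r → P))
    (hS : ∀ σ : Γ, ∀ R ∈ S, (fun k ↦ ∑ i, LinearMap.toMatrix b b (ρ σ) k i • σ • R i) ∈ S)
    (π' : S →+ AddSubgroup.torsionBy P ℓ) (hSℓ : ∀ R ∈ S, ℓ • R = 0) (hπ's : Function.Surjective π')
    (hπ't : ∀ (σ : Γ) (R : S), π' ⟨_, hS σ R R.2⟩ = σ • π' R) :
    ∃ (S₀' : Submodule (ZMod ℓ) (Fin r → ZMod ℓ)) (x : Fin r → ZMod ℓ), x ∉ S₀' ∧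
      ∀ σ : Γ, ((LinearMap.toMatrix b b (ρ σ)).map (Int.cast : ℤ → ZMod ℓ)).mulVec x - x ∈ S₀' := by
  classical
  set c : Γ → Matrix (Fin r) (Fin r) ℤ := fun σ ↦ LinearMap.toMatrix b b (ρ σ) with hc
  change ∀ σ : Γ, ∀ R ∈ S, (fun k ↦ ∑ i, c σ k i • σ • R i) ∈ S at hS
  -- smul bookkeeping on `V = P[ℓ]`
  have hsmulV : ∀ (σ : Γ) (a : ZMod ℓ) (v : AddSubgroup.torsionBy P ℓ), σ • a • v = a • σ • v :=
      fun σ a v ↦ by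
    have h := ZMod.map_smul (DistribSMul.toAddMonoidHom (AddSubgroup.torsionBy P ℓ) σ) a v
    rwa [DistribSMul.toAddMonoidHom_apply, DistribSMul.toAddMonoidHom_apply] at h
  have hπ'congr : ∀ (R₁ R₂ : Fin r → P) (h₁ : R₁ ∈ S) (h₂ : R₂ ∈ S), R₁ = R₂ →
      π' ⟨R₁, h₁⟩ = π' ⟨R₂, h₂⟩ := by
    rintro R₁ R₂ h₁ h₂ rfl; rfl
  -- coordinates `V^r → P^r`
  let incl : (Fin r → AddSubgroup.torsionBy P ℓ) →+ (Fin r → P) :=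
    AddMonoidHom.pi fun i ↦ (AddSubgroup.torsionBy P ℓ).subtype.comp (Pi.evalAddMonoidHom _ i)
  have hincl : ∀ R i, incl R i = (R i : P) := fun R i ↦ rfl
  -- the operators of `Γ' = ker ρ` are diagonal
  have hdiag : ∀ σ : Γ, σ ∈ MonoidHom.ker ρ → ∀ R : Fin r → P,
      (fun k ↦ ∑ i, c σ k i • σ • R i) = fun k ↦ σ • R k := fun σ hσ R ↦ by
    rw [MonoidHom.mem_ker] at hσ
    ext k
    have hck : ∀ i, c σ k i = if k = i then 1 else 0 := fun i ↦ by
      simp only [hc, hσ]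
      rw [show (1 : H →ₗ[ℤ] H) = LinearMap.id from rfl, LinearMap.toMatrix_id, Matrix.one_apply]
    simp only [hck, ite_smul, one_smul, zero_smul, Finset.sum_ite_eq, Finset.mem_univ, if_true]
  -- the general operators on pure tensors
  have htwist : ∀ (σ : Γ) (x : Fin r → ZMod ℓ) (v : AddSubgroup.torsionBy P ℓ),
      (fun k ↦ ∑ i, c σ k i • σ • incl (fun i ↦ x i • v) i) =
        incl (fun k ↦ ((c σ).map (Int.cast : ℤ → ZMod ℓ)).mulVec x k • σ • v) := fun σ x v ↦ by
    ext k
    rw [hincl, Matrix.mulVec, dotProduct, Finset.sum_smul, AddSubgroup.val_finsetSum]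
    refine Finset.sum_congr rfl fun i _ ↦ ?_
    rw [hincl, Matrix.map_apply, mul_smul, Int.cast_smul_eq_zsmul, AddSubgroupClass.coe_zsmul,
      ← hsmulV]
    rfl
  -- `SV = S ∩ V^r` and `KV = ker π' ∩ V^r`
  let SV : AddSubgroup (Fin r → AddSubgroup.torsionBy P ℓ) := S.comap incl
  let KV : AddSubgroup (Fin r → AddSubgroup.torsionBy P ℓ) := (π'.ker.map S.subtype).comap incl
  have hSV : ∀ R, R ∈ SV ↔ incl R ∈ S := fun R ↦ AddSubgroup.mem_comap
  have hKV : ∀ R, R ∈ KV ↔ ∃ h : incl R ∈ S, π' ⟨incl R, h⟩ = 0 := fun R ↦ by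
    constructor
    · rintro ⟨y, hy, hyR⟩
      have h : incl R ∈ S := by rw [← hyR]; exact y.2
      refine ⟨h, ?_⟩
      have hy0 : π' y = 0 := hy
      rw [← hy0]
      congr 1
      exact Subtype.ext hyR.symm
    · rintro ⟨h, h0⟩
      exact ⟨⟨incl R, h⟩, h0, rfl⟩
  -- stability of `SV`, `KV` under the diagonal operators of `Γ'`, hence under all of `End(V)`
  have hSVst : ∀ σ : MonoidHom.ker ρ, ∀ R ∈ SV, (fun i ↦ (σ : Γ) • R i) ∈ SV := fun σ R hR ↦ by
    rw [hSV] at hR ⊢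
    have h := hS σ _ hR
    rwa [hdiag σ σ.2] at h
  have hKVst : ∀ σ : MonoidHom.ker ρ, ∀ R ∈ KV, (fun i ↦ (σ : Γ) • R i) ∈ KV := fun σ R hR ↦ by
    rw [hKV] at hR ⊢
    obtain ⟨h, h0⟩ := hR
    have h' : incl (fun i ↦ (σ : Γ) • R i) ∈ S := by
      have h1 := hS σ _ h
      rwa [hdiag σ σ.2] at h1
    refine ⟨h', ?_⟩
    have h2 := hπ't σ ⟨incl R, h⟩
    rw [h0, smul_zero] at h2
    rw [← h2]
    exact hπ'congr _ _ _ _ (by rw [hdiag σ σ.2]; rfl)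
  have hall : ∀ (φ : AddSubgroup.torsionBy P ℓ →ₗ[ZMod ℓ] AddSubgroup.torsionBy P ℓ) (T :
      AddSubgroup (Fin r → AddSubgroup.torsionBy P ℓ)),
      (∀ σ : MonoidHom.ker ρ, ∀ R ∈ T, (fun i ↦ (σ : Γ) • R i) ∈ T) →
      ∀ R ∈ T, (fun i ↦ φ (R i)) ∈ T := by
    intro φ T hT R hR
    have h := forall_mem_of_span_eq_top hspan
      (fun (φ : AddSubgroup.torsionBy P ℓ →ₗ[ZMod ℓ] AddSubgroup.torsionBy P ℓ) (R : Fin r →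
          AddSubgroup.torsionBy P ℓ) ↦ fun i ↦ φ (R i))
      (fun φ ψ R ↦ rfl) (fun a φ R ↦ rfl) (AddSubgroup.toZModSubmodule ℓ T) ?_ φ
      ((AddSubgroup.mem_toZModSubmodule ℓ).2 hR)
    · exact (AddSubgroup.mem_toZModSubmodule ℓ).1 h
    · rintro _ ⟨σ, rfl⟩ R hR
      exact (AddSubgroup.mem_toZModSubmodule ℓ).2
        (hT σ R ((AddSubgroup.mem_toZModSubmodule ℓ).1 hR))
  -- `S₀` and `S₀'`
  let S₀ : Set (Fin r → ZMod ℓ) := {x | ∀ w, (fun i ↦ x i • w) ∈ SV}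
  let S₀' : Submodule (ZMod ℓ) (Fin r → ZMod ℓ) :=
    { carrier := {x | ∀ w, (fun i ↦ x i • w) ∈ KV}
      add_mem' := fun {x y} hx hy w ↦ by
        have h := KV.add_mem (hx w) (hy w)
        convert h using 1
        ext i; simp [add_smul]
      zero_mem' := fun w ↦ by
        convert KV.zero_mem using 1
        ext i; simp
      smul_mem' := fun a x hx w ↦ by
        have h := ZMod.smul_mem (K := KV) (hx w) a
        convert h using 1
        ext i; simp [mul_smul] }
  have hmemS₀' : ∀ x, x ∈ S₀' ↔ ∀ w, (fun i ↦ x i • w) ∈ KV := fun x ↦ Iff.rfl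
  -- Step 1: some `x ∈ S₀ ∖ S₀'`
  obtain ⟨x, hx, hx'⟩ : ∃ x ∈ S₀, x ∉ S₀' := by
    by_contra hcon
    push Not at hcon
    have hzero : ∀ (R) (hR : R ∈ S), π' ⟨R, hR⟩ = 0 := by
      intro R hR
      -- lift `R` to `V^r`
      let R' : Fin r → AddSubgroup.torsionBy P ℓ := fun i ↦ ⟨R i, by
        have h := congrFun (hSℓ R hR) i
        rw [Pi.smul_apply, Pi.zero_apply] at h
        exact AddSubgroup.torsionBy.nsmul_iff.2 h⟩
      have hR' : incl R' = R := rfl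
      have hR'SV : R' ∈ SV := by rw [hSV, hR']; exact hR
      -- its coordinate vectors lie in `S₀ ⊆ S₀'`
      have hcoord : ∀ j : Fin 2, (fun i ↦ bV.repr (R' i) j) ∈ S₀ := fun j w ↦ by
        have h := hall ((bV.coord j).smulRight w) SV hSVst R' hR'SV
        simpa only [LinearMap.smulRight_apply, Module.Basis.coord_apply] using h
      have hK : R' ∈ KV := by
        have hsum : R' = (fun i ↦ bV.repr (R' i) 0 • bV 0) + fun i ↦ bV.repr (R' i) 1 • bV 1 := by
          ext i
          have h := bV.sum_repr (R' i)
          rw [Fin.sum_univ_two] at h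
          exact congrArg Subtype.val h.symm
        rw [hsum]
        exact KV.add_mem (hcon _ (hcoord 0) (bV 0)) (hcon _ (hcoord 1) (bV 1))
      obtain ⟨h, h0⟩ := (hKV R').1 hK
      rw [← h0]
      exact hπ'congr _ _ _ _ hR'.symm
    obtain ⟨R₁, hR₁⟩ := hπ's (bV 0)
    exact bV.ne_zero 0 (by rw [← hR₁]; exact hzero R₁ R₁.2)
  -- Step 2: `θ(w) = π'(x ⊗ w)` is a scalar
  have hxS : ∀ w, incl (fun i ↦ x i • w) ∈ S := fun w ↦ (hSV _).1 (hx w)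
  let θ : AddSubgroup.torsionBy P ℓ →+ AddSubgroup.torsionBy P ℓ :=
    { toFun := fun w ↦ π' ⟨incl (fun i ↦ x i • w), hxS w⟩
      map_zero' := by
        have h : (⟨incl (fun i ↦ x i • (0 : AddSubgroup.torsionBy P ℓ)), hxS 0⟩ : S) = 0 := by
          apply Subtype.ext
          change incl _ = 0
          rw [← map_zero incl]
          congr 1; ext i; simp
        rw [h, map_zero]
      map_add' := fun v w ↦ by
        rw [← map_add]
        congr 1
        apply Subtype.ext
        change incl _ = incl _ + incl _
        rw [← map_add]
        congr 1; ext i; simp [smul_add] }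
  have hθ : ∀ w, θ w = π' ⟨incl (fun i ↦ x i • w), hxS w⟩ := fun w ↦ rfl
  have hθσ : ∀ σ : MonoidHom.ker ρ, ∀ v, θ ((σ : Γ) • v) = (σ : Γ) • θ v := fun σ v ↦ by
    rw [hθ, hθ, ← hπ't]
    apply hπ'congr
    change incl (fun i ↦ x i • (σ : Γ) • v) = fun k ↦ ∑ i, c σ k i • (σ : Γ) • incl (fun i ↦ x i •
        v) i
    rw [hdiag σ σ.2]
    ext k
    rw [hincl, hincl, ← hsmulV]
    rfl
  obtain ⟨c₀, hc₀⟩ := exists_eq_smul_of_commute bV hspan (θ.toZModLinearMap ℓ) (by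
    rintro _ ⟨σ, rfl⟩
    refine LinearMap.ext fun v ↦ ?_
    exact (hθσ σ v).symm)
  replace hc₀ : ∀ v, θ v = c₀ • v := hc₀
  -- Step 3: `c̄(σ) x - x ∈ S₀'`
  refine ⟨S₀', x, hx', fun σ w ↦ ?_⟩
  change (fun i ↦ (((c σ).map (Int.cast : ℤ → ZMod ℓ)).mulVec x - x) i • w) ∈ KV
  set v := σ⁻¹ • w with hv
  have hvw : σ • v = w := smul_inv_smul σ w
  have hmem : incl (fun k ↦ ((c σ).map (Int.cast : ℤ → ZMod ℓ)).mulVec x k • w) ∈ S := by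
    rw [← hvw, ← htwist]
    exact hS σ _ (hxS v)
  have hval : π' ⟨_, hmem⟩ = π' ⟨_, hxS w⟩ := by
    have h1 : π' ⟨_, hmem⟩ = σ • θ v := by
      rw [hθ, ← hπ't σ ⟨_, hxS v⟩]
      apply hπ'congr
      change incl _ = fun k ↦ ∑ i, c σ k i • σ • incl (fun i ↦ x i • v) i
      rw [htwist σ x v, hvw]
    rw [h1, hc₀, hsmulV, hvw, ← hc₀, hθ]
  rw [hKV]
  refine ⟨?_, ?_⟩
  · have h := S.sub_mem hmem (hxS w)
    rw [← map_sub] at h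
    convert h using 2
    ext i; simp [sub_smul]
  · rw [← sub_eq_zero, ← map_sub] at hval
    rw [← hval]
    apply hπ'congr
    change incl _ = incl _ - incl _
    rw [← map_sub]
    congr 1; ext i; simp [sub_smul]

end BigImage

/-! ## The core, step 2: averaging (registered sub-goal of the stub) -/

/-- **Core, step 2 (averaging).** If the image `G = ρ(Γ)` is finite of order prime to `ℓ` and
`H` has no non-zero `Γ`-invariants, no vector `x ∈ 𝔽_ℓ^r` can span a `Γ`-invariant line modulo
a subspace `S₀'` not containing it: lift `x` to `f ∈ H ≅ ℤ^r`; each `ρ(σ)f - f` reduces into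
`S₀'`, so the invariant average `Σ_{u ∈ G} u f` (which vanishes) is `≡ |G| f`, forcing
`|G| x ∈ S₀'`, i.e. `x ∈ S₀'`. [folklore] -/
theorem false_of_invariant_line {Γ H : Type} [Group Γ] [AddCommGroup H] {ℓ : ℕ} [Fact ℓ.Prime]
    (ρ : Representation ℤ Γ H) {r : ℕ} (b : Module.Basis (Fin r) ℤ H)
    [Fintype ρ.asGroupHom.range] (hℓ : ¬ ℓ ∣ Fintype.card ρ.asGroupHom.range)
    (hfix : ∀ f : H, (∀ σ, ρ σ f = f) → f = 0)
    (S₀' : Submodule (ZMod ℓ) (Fin r → ZMod ℓ)) (x : Fin r → ZMod ℓ) (hx : x ∉ S₀')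
    (hσ : ∀ σ : Γ,
      ((LinearMap.toMatrix b b (ρ σ)).map (Int.cast : ℤ → ZMod ℓ)).mulVec x - x ∈ S₀') :
    False := by
  classical
  -- lift `x` to `f ∈ H`
  let xZ : Fin r → ℤ := fun i ↦ ((x i).val : ℤ)
  let red : (Fin r → ℤ) →+ (Fin r → ZMod ℓ) := (Int.castAddHom (ZMod ℓ)).compLeft (Fin r)
  have hred : ∀ y i, red y i = (y i : ZMod ℓ) := fun y i ↦ rfl
  have hredx : red xZ = x := by
    ext i
    rw [hred]
    simp [xZ]
  let f : H := b.equivFun.symm xZ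
  have hf : b.equivFun f = xZ := b.equivFun.apply_symm_apply xZ
  -- `good g`: the reduction of the coordinates of `g` lies in `S₀'`
  let good : H → Prop := fun g ↦ red (b.equivFun g) ∈ S₀'
  have good_zero : good 0 := by
    change red (b.equivFun 0) ∈ S₀'
    rw [map_zero, map_zero]; exact S₀'.zero_mem
  have good_add : ∀ g g', good g → good g' → good (g + g') := fun g g' hg hg' ↦ by
    change red (b.equivFun (g + g')) ∈ S₀'
    rw [map_add, map_add]; exact S₀'.add_mem hg hg'
  have good_neg : ∀ g, good g → good (-g) := fun g hg ↦ by
    change red (b.equivFun (-g)) ∈ S₀'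
    rw [map_neg, map_neg]; exact S₀'.neg_mem hg
  -- each `ρ σ f - f` is good
  have hmove : ∀ σ : Γ, good (ρ σ f - f) := fun σ ↦ by
    change red (b.equivFun (ρ σ f - f)) ∈ S₀'
    rw [map_sub, map_sub, hf, hredx]
    convert hσ σ using 2
    have hrepr : (⇑(b.repr f) : Fin r → ℤ) = xZ := by rw [← Module.Basis.equivFun_apply, hf]
    have hcomp : (Int.cast : ℤ → ZMod ℓ) ∘ xZ = x := by
      ext j; rw [Function.comp_apply, ← hred, hredx]
    ext i
    rw [hred, Module.Basis.equivFun_apply, ← LinearMap.toMatrix_mulVec_repr b b (ρ σ) f]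
    change Int.castRingHom (ZMod ℓ) (((LinearMap.toMatrix b b (ρ σ)).mulVec ⇑(b.repr f)) i) = _
    rw [RingHom.map_mulVec, Int.coe_castRingHom, hrepr, hcomp]
  -- the invariant average vanishes
  let z : H := ∑ u : ρ.asGroupHom.range, ((u : (H →ₗ[ℤ] H)ˣ) : H →ₗ[ℤ] H) f
  have hz : ∀ σ, ρ σ z = z := fun σ ↦ by
    simp only [z, map_sum]
    refine Fintype.sum_bijective (fun u ↦ ⟨ρ.asGroupHom σ, σ, rfl⟩ * u)
      (Group.mulLeft_bijective _) _ _ fun u ↦ ?_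
    simp only [Subgroup.coe_mul, Units.val_mul, Module.End.mul_apply,
        Representation.asGroupHom_apply]
  have hz0 : z = 0 := hfix z hz
  -- `z - |G| f` is good
  have hgood : good (z - Fintype.card ρ.asGroupHom.range • f) := by
    have hsum : z - Fintype.card ρ.asGroupHom.range • f =
        ∑ u : ρ.asGroupHom.range, (((u : (H →ₗ[ℤ] H)ˣ) : H →ₗ[ℤ] H) f - f) := by
      rw [Finset.sum_sub_distrib, Finset.sum_const, Finset.card_univ]
    rw [hsum]
    refine Finset.sum_induction _ good (fun g g' ↦ good_add g g') good_zero fun u _ ↦ ?_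
    obtain ⟨u, σ, hσu⟩ := u
    have h : ((u : (H →ₗ[ℤ] H)ˣ) : H →ₗ[ℤ] H) = ρ σ := by
      rw [← hσu, Representation.asGroupHom_apply]
    change good (((u : (H →ₗ[ℤ] H)ˣ) : H →ₗ[ℤ] H) f - f)
    rw [h]
    exact hmove σ
  rw [hz0, zero_sub] at hgood
  have hgood' := good_neg _ hgood
  rw [neg_neg] at hgood'
  change red (b.equivFun (Fintype.card ρ.asGroupHom.range • f)) ∈ S₀' at hgood'
  rw [map_nsmul, map_nsmul, hf, hredx, ← Nat.cast_smul_eq_nsmul (ZMod ℓ)] at hgood'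
  have hunit : ((Fintype.card ρ.asGroupHom.range : ℕ) : ZMod ℓ) ≠ 0 := by
    rwa [Ne, ZMod.natCast_eq_zero_iff]
  apply hx
  have h := S₀'.smul_mem ((Fintype.card ρ.asGroupHom.range : ℕ) : ZMod ℓ)⁻¹ hgood'
  rwa [inv_smul_smul₀ hunit] at h


end Summit.ABC.ABC.Theorems.IsotypicMinkowski

end
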